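import Summits.BirchSwinnertonDyer.Rank1Residual.GaloisImage.IrreducibleModThreeCentralInvolution
import Summits.BirchSwinnertonDyer.Rank1Residual.GaloisImage.InflationRestrictionSakamotoH3
import Summits.BirchSwinnertonDyer.Rank1Residual.GaloisImage.SakamotoN11Instance
import HarnessLib

/-!
# Sakamoto's (H.3) at EVERY level `3^{k+1}` for EVERY `E/ℚ` with `E[3]` irreducible, and the N11
# instance of Thm. 4.4 (1) re-keyed on `Irr W 3` + the `τ` of (H.2) — O8-TAME part 12a
# (cell `b2b-bsdres`, lane CLASS-CLOSURE, seat cc-typer-1 = typer of record N11 / O8, GEN 11; joint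
# small-image axis O8 / N2 / N3; sequel of `IrreducibleModThreeCentralInvolution.lean` = part 11c)

HONEST FRAMING (cell `b2b-bsdres`, run/shared/lean/b2b/bsd-rank1-residual/, verbatim in every
file): the goal of the cell is to DELETE the COMBINATION-SHAPED residual classes of the
Birch–Swinnerton-Dyer formula for ALL analytic-rank `≤ 1` elliptic curves over `ℚ` — "full BSD
formula for every rank `≤ 1` curve in class `C`" assembled STRICTLY from published theorems — so
that the rank-`≤ 1` remainder becomes exactly the CONSTRUCTION-SHAPED classes, which are TYPED
(missing-input `Prop`s), NOT attempted. This is not "finishing BSD". THEOREMS ONLY: no definition,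
no named fact, no conjecture node, nothing booked, no label of `RESIDUAL-MAP.md` moved; census
counts are EVIDENCE, never a Literature fact.

## What this file does (E2 obstruction anatomy of the Kolyvagin-system route on X4 at `3`)

Part 11c put `−1` in `ρ̄_{E,3}(Γ_ℚ)` for every `E/ℚ` with `E[3]` irreducible and deduced Sakamoto's
(H.3) at LEVEL ONE. The N11 instance of Sakamoto 2024 Thm. 4.4 (1) (n1011-p13,
`GaloisImage.kolyvaginSystems_freeRankOne_propagatedSelmerStructure`) needs (H.3) at level `3^{k+1}`
(`T = E[3^{k+1}]`, `T̄ = E[3]`), which n1011-p04 discharged from SURJECTIVITY of `ρ̄_{E,3^{k+1}}`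
(`hH3_of_hasSurjectiveModNGaloisRep`, `hH3_three_of_towerSurj`). Here the tower is removed:

* §1 (pure algebra, any monoid `Γ` acting on an abelian group `M`, `p` odd)
  **`NegOneLift.pow_smul_eq_neg_of_smul_eq_neg_torsion`** — if `γ` acts as `−1` on `M[p]` then
  `γ^{p^k}` acts as `−1` on `M[p^{k+1}]`, for every `k` (basis-free, no freeness of `M`; induction on
  `k`: with `w = γ^{p^k}` and `y = w x + x` one has `p y = 0`, `w y = −y`, and
  `w^{2m+1} x = −x + (2m+1) y`, so `w^p x = −x`). The `p = 3` matrix-free lift of x11b3-p7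
  (`X11b/Three/TorsionNegOneLift`, Lawson–Wuthrich 2016 Lemma 3) is the special case `p = 3` in the
  level spelling `3^m`; this is the odd-`p` form in the N11 files' spelling `p^k · p`.
* §2 **`pow_smul_eq_neg_torsion_pow_mul`** — for `E` over any field and `z ∈ Γ_F` acting as `−1` on
  `E[p]`: `z^{p^k}` acts as `−1` on `E[p^k · p]`.
* §3 **`hH3_of_smul_eq_neg`** — `E/ℚ`, `p` odd, SOME `z ∈ Γ_ℚ` acting as `−1` on `E[p]` ⟹ (H.3)
  at level `p^{k+1}` for every `k`: every continuous crossed homomorphism `Γ_ℚ → E[p]` vanishing on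
  `ker ρ̄_{E,p^{k+1}} ∩ Gal(ℚ̄/ℚ(μ_{p^{k+1}}))` is principal (n1011-p04's Sah argument
  `InflRes.h3_of_commute` with the central element `ρ̄_{E,p^{k+1}}(z^{p^k}) = −1`).
* §4 **`exists_smul_eq_neg_three_pow_mul_of_irr`**, **`hH3_three_pow_of_irr`** — at `p = 3` from
  `Irr W 3` ALONE (part 11c supplies `z`): `−1 ∈ ρ̄_{E,3^{k+1}}(Γ_ℚ)` and **(H.3) at EVERY level on
  EVERY `E/ℚ` with `E[3]` irreducible** — VERBATIM the binder `hH3` of p13's instance (same spelling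
  of the level `((3 : ℕ) : ℤ) ^ k * ((3 : ℕ) : ℤ)` and of `rootsOfUnityFixer ℚ (3 ^ (k + 1))`).
  Class forms **`O8.hH3_three_pow`** (`ClassX4 W 3`: every N11 row and every O8 row at `3`) and
  **`ClassX10.hH3_three_pow`** (N2 = X10b).
* §5 **`kolyvaginSystems_freeRankOne_propagatedSelmerStructure_of_irr`** — p13's N11 instance of
  Sakamoto Thm. 4.4 (1) with the tower binder `htower` REPLACED by `Irr W 3` and the binder `hH3`
  DISCHARGED: (H.1) is `Irr W 3` itself, (H.3) is §4. The image-theoretic input of the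
  Kolyvagin-system route on class X4 at `3` is thereby EXACTLY (H.1) = the class definition plus the
  `τ` of (H.2) (binders `τ, hτμ, hτq`) — which EXISTS at every level under the `3`-adic tower
  (`exists_rootsOfUnityFixer_cokerSubOne_equiv_of_towerSurj`), FAILS at level `9` on the exotic
  `9`-deficient rows (n1011-p13 `ExoticNoLevelTwoTau`) and FAILS at every level on the small-image
  rows O8 / N2 / N3 (part 11d `SmallImageNoLevelOneTau`). (H.3) is never the obstruction.

NOT claimed: (H.2) from anything weaker than the tower; `p = 2`; any statement at `p ≥ 5` beyond §3
(where `−1 ∈ ρ̄_{E,p}(Γ_ℚ)` is an INPUT: part 11a gives it on `(G) ∧ ss`, surjectivity gives it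
always); core rank, coisotropy, the Kolyvagin datum or any BSD-type class theorem; no label moves;
the re-keyed instance stays CONDITIONAL on the named fact `hS24` exactly as p13's.

References: [Sakamoto2024] R. Sakamoto, JTNB 36 (2024) §2 (H.1)–(H.3), Thm. 4.4 (1);
[MazurRubin2004] B. Mazur, K. Rubin, Mem. AMS 799 (2004) §3.5, Lemma 3.5.2; [LawsonWuthrich2016]
T. Lawson, C. Wuthrich, Springer PROMS 188 (2016) Lemma 3 (the lift `−I ∈ im ρ̄₃ ⇒ −I ∈ im ρ_{3^i}`);
C.-H. Sah, J. Algebra 10 (1968); [Serre1972] J.-P. Serre, Invent. Math. 15 (1972) §2.4 Prop. 15.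
-/

set_option autoImplicit false

noncomputable section

open scoped Classical NumberField Pointwise ContRepresentation

open Field IsDedekindDomain NumberField WeierstrassCurve
  Literature.NumberTheory.EllipticCurves Literature.NumberTheory.GaloisRepresentations
  Literature.NumberTheory.GaloisRepresentations.DiscreteGaloisModule
  Literature.NumberTheory.GaloisCohomology
  Literature.NumberTheory.EllipticCurves.Rank1Residual
  Summit.BirchSwinnertonDyer.Rank1Residual.Additive

namespace Summit.BirchSwinnertonDyer.Rank1Residual.GaloisImage

/-! ## §1. The basis-free lift of `−1` up an odd-primary torsion tower -/

namespace NegOneLift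

variable {Γ M : Type*} [Monoid Γ] [AddCommGroup M] [DistribMulAction Γ M]

/-- If `w x = y − x` and `w y = −y` then `w^{2m+1} x = −x + (2m+1) y`. [folklore] -/
theorem pow_odd_smul_eq (w : Γ) (x y : M) (hx : w • x = y - x) (hy : w • y = -y) (m : ℕ) :
    w ^ (2 * m + 1) • x = -x + (2 * m + 1) • y := by
  induction m with
  | zero => rw [Nat.mul_zero, Nat.zero_add, pow_one, one_smul, hx]; abel
  | succ m ih =>
    have hwn : ∀ (n : ℕ) (v : M), w • (n • v) = n • (w • v) := fun n v => smul_comm w n v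
    have hpow : w ^ (2 * (m + 1) + 1) = w * (w * w ^ (2 * m + 1)) := by
      rw [show 2 * (m + 1) + 1 = 2 * m + 1 + 1 + 1 by ring, pow_succ', pow_succ']
    have hsc : (2 * (m + 1) + 1) • y = (2 * m + 1) • y + y + y := by
      rw [show 2 * (m + 1) + 1 = 2 * m + 1 + 1 + 1 by ring, add_smul, add_smul, one_smul]
    rw [hpow, hsc, mul_smul, mul_smul, ih]
    simp only [smul_add, smul_neg, smul_sub, hx, hy, hwn, neg_neg]
    abel

/-- **The lift.** Let a monoid `Γ` act on an abelian group `M` and let `p` be odd. If `γ ∈ Γ` acts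
as `−1` on the `p`-torsion `M[p]`, then for every `k` the power `γ^{p^k}` acts as `−1` on the
`p^{k+1}`-torsion `M[p^{k+1}]` (no basis, no freeness of `M`). The `p = 3` case in the spelling `3^m`
is x11b3-p7's `X11b.Three.TorsionLift.smul_pow_three_pow_eq_neg`.
[cite: LawsonWuthrich2016, Lemma 3] -/
theorem pow_smul_eq_neg_of_smul_eq_neg_torsion {p : ℕ} (hp : Odd p) (γ : Γ)
    (h1 : ∀ x : M, p • x = 0 → γ • x = -x) :
    ∀ (k : ℕ) (x : M), p ^ (k + 1) • x = 0 → γ ^ (p ^ k) • x = -x := by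
  intro k
  induction k with
  | zero =>
    intro x hx
    rw [pow_zero, pow_one]
    exact h1 x (by rwa [Nat.zero_add, pow_one] at hx)
  | succ k ih =>
    intro x hx
    -- `w = γ^{p^k}` acts as `−1` on `M[p^{k+1}] ∋ p x`, and on `y = w x + x ∈ M[p]`
    have hpx : p ^ (k + 1) • (p • x) = 0 := by rw [smul_smul, ← pow_succ]; exact hx
    have hwpx : γ ^ (p ^ k) • (p • x) = -(p • x) := ih (p • x) hpx
    have hpy : p • (γ ^ (p ^ k) • x + x) = 0 := by
      rw [smul_add, smul_comm p (γ ^ (p ^ k)) x, hwpx, neg_add_cancel]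
    have hy1 : p ^ (k + 1) • (γ ^ (p ^ k) • x + x) = 0 := by
      rw [pow_succ, mul_smul, hpy, smul_zero]
    have hwy : γ ^ (p ^ k) • (γ ^ (p ^ k) • x + x) = -(γ ^ (p ^ k) • x + x) := ih _ hy1
    have hwx : γ ^ (p ^ k) • x = (γ ^ (p ^ k) • x + x) - x := by abel
    obtain ⟨m, hm⟩ := hp
    have key := pow_odd_smul_eq (γ ^ (p ^ k)) x (γ ^ (p ^ k) • x + x) hwx hwy m
    rw [← hm, hpy, add_zero, ← pow_mul, ← pow_succ] at key
    exact key

end NegOneLift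

/-! ## §2. Torsion points: `z = −1` on `E[p]` ⟹ `z^{p^k} = −1` on `E[p^k · p]` -/

section AnyField

variable {F : Type} [Field F] (W : WeierstrassCurve F)

/-- **`z ∈ Γ_F` acts as `−1` on `E[p]`, `p` odd ⟹ `z^{p^k}` acts as `−1` on `E[p^k · p]`**, for
every `k` (the level spelling of the N11 files). [cite: LawsonWuthrich2016, Lemma 3] -/
theorem pow_smul_eq_neg_torsion_pow_mul {p : ℕ} (hp : Odd p) (k : ℕ) (z : absoluteGaloisGroup F)
    (hz : ∀ P : geomTorsion W ((p : ℕ) : ℤ), z • P = -P)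
    (P : geomTorsion W (((p : ℕ) : ℤ) ^ k * ((p : ℕ) : ℤ))) : z ^ (p ^ k) • P = -P := by
  refine NegOneLift.pow_smul_eq_neg_of_smul_eq_neg_torsion hp z ?_ k P ?_
  · -- an element of `E[p^k · p]` killed by `p` is an element of `E[p]`
    intro x hx
    have hx' : ((p : ℕ) : ℤ) • (x : geomPoints W) = 0 := by
      have h := congrArg (fun y : geomTorsion W (((p : ℕ) : ℤ) ^ k * ((p : ℕ) : ℤ)) =>
        (y : geomPoints W)) hx
      simpa only [AddSubmonoidClass.coe_nsmul, natCast_zsmul, ZeroMemClass.coe_zero] using h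
    have hmem : (x : geomPoints W) ∈ geomTorsion W ((p : ℕ) : ℤ) :=
      (Submodule.mem_torsionBy_iff _ _).mpr hx'
    have h := congrArg Subtype.val (hz ⟨(x : geomPoints W), hmem⟩)
    rw [AddSubgroup.torsionBy.coe_smul, NegMemClass.coe_neg] at h
    apply Subtype.ext
    rw [AddSubgroup.torsionBy.coe_smul, NegMemClass.coe_neg]
    exact h
  · -- `E[p^k · p]` is killed by `p^{k+1}`
    have hP : (((p : ℕ) : ℤ) ^ k * ((p : ℕ) : ℤ)) • (P : geomPoints W) = 0 :=
      (Submodule.mem_torsionBy_iff _ _).mp P.2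
    apply Subtype.ext
    rw [AddSubmonoidClass.coe_nsmul, ZeroMemClass.coe_zero, ← natCast_zsmul]
    simpa only [Nat.cast_pow, Nat.cast_mul, pow_succ] using hP

/-- **`−1 ∈ ρ̄_{E,p^k·p}(Γ_F)` from one element acting as `−1` on `E[p]`** (`p` odd, every `k`).
[cite: LawsonWuthrich2016, Lemma 3] -/
theorem exists_smul_eq_neg_torsion_pow_mul_of_exists {p : ℕ} (hp : Odd p) (k : ℕ)
    (hz : ∃ z : absoluteGaloisGroup F, ∀ P : geomTorsion W ((p : ℕ) : ℤ), z • P = -P) :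
    ∃ z : absoluteGaloisGroup F,
      ∀ P : geomTorsion W (((p : ℕ) : ℤ) ^ k * ((p : ℕ) : ℤ)), z • P = -P := by
  obtain ⟨z, hz⟩ := hz
  exact ⟨z ^ (p ^ k), pow_smul_eq_neg_torsion_pow_mul W hp k z hz⟩

end AnyField

/-! ## §3. (H.3) at level `p^{k+1}` from ONE element acting as `−1` on `E[p]` (`p` odd) -/

section Rat

variable (W : WeierstrassCurve ℚ)

/-- **(H.3) of Sakamoto 2024 at level `p^{k+1}` from `−1 ∈ ρ̄_{E,p}(Γ_ℚ)`, `p` odd.** If some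
`z ∈ Γ_ℚ` acts as `−1` on `E[p]`, then for every `k` every continuous crossed homomorphism
`f : Γ_ℚ → E[p]` vanishing on `ker ρ̄_{E,p^{k+1}} ∩ Gal(ℚ̄/ℚ(μ_{p^{k+1}}))` is principal
(`T = E[p^{k+1}]`, `T̄ = E[p]`): `z^{p^k}` acts as the CENTRAL element `−1` on `E[p^{k+1}]` (§2) and as
`−1` on `E[p]`, with `−1 − 1 = −2` invertible on `E[p]` — n1011-p04's Sah argument
`InflRes.h3_of_commute`, whose only use of surjectivity was to find such an element.
[cite: Sakamoto2024, §2 (H.3)] [cite: MazurRubin2004, Lemma 3.5.2] [cite: LawsonWuthrich2016, Lemma 3] -/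
theorem hH3_of_smul_eq_neg (p k : ℕ) [Fact p.Prime] (hp : p ≠ 2) (z : absoluteGaloisGroup ℚ)
    (hz : ∀ P : geomTorsion W ((p : ℕ) : ℤ), z • P = -P)
    (f : contOneCocycles (W.torsionGaloisModule ((p : ℕ) : ℤ)).toTopRep)
    (hf : ∀ u : absoluteGaloisGroup ℚ,
      (W.torsionGaloisModule (((p : ℕ) : ℤ) ^ k * ((p : ℕ) : ℤ))) u = 1 →
        u ∈ rootsOfUnityFixer ℚ (p ^ (k + 1)) → f.1 u = 0) :
    oneCocycleClass (W.torsionGaloisModule ((p : ℕ) : ℤ)).toTopRep f = 0 := by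
  have hpP : p.Prime := Fact.out
  have hp0 : p ≠ 0 := hpP.ne_zero
  haveI : NeZero (p ^ (k + 1)) := ⟨pow_ne_zero _ hp0⟩
  haveI : NeZero ((p ^ (k + 1) : ℕ) : ℚ) := ⟨Nat.cast_ne_zero.mpr (pow_ne_zero _ hp0)⟩
  set z' : absoluteGaloisGroup ℚ := z ^ (p ^ k) with hz'def
  have hz' : ∀ P : geomTorsion W (((p : ℕ) : ℤ) ^ k * ((p : ℕ) : ℤ)), z' • P = -P :=
    pow_smul_eq_neg_torsion_pow_mul W (hpP.odd_of_ne_two hp) k z hz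
  have hz'p : ∀ x : geomTorsion W ((p : ℕ) : ℤ), z' • x = -x :=
    smul_eq_neg_torsion_of_smul_eq_neg W p k z' hz'
  have hρz : (W.torsionGaloisModule (((p : ℕ) : ℤ) ^ k * ((p : ℕ) : ℤ))) z' = -1 :=
    LinearMap.ext fun x => by rw [torsionGaloisModule_apply_apply, hz']; rfl
  have hρbarz : (W.torsionGaloisModule ((p : ℕ) : ℤ)) z' = -1 :=
    LinearMap.ext fun x => by rw [torsionGaloisModule_apply_apply, hz'p]; rfl
  have htors : ∀ x : geomTorsion W ((p : ℕ) : ℤ), p • x = 0 := fun x => by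
    have hx : ((p : ℕ) : ℤ) • (x : geomPoints W) = 0 := (Submodule.mem_torsionBy_iff _ _).mp x.2
    apply Subtype.ext
    rw [AddSubmonoidClass.coe_nsmul, ZeroMemClass.coe_zero, ← natCast_zsmul]
    exact hx
  refine InflRes.h3_of_commute (W.torsionGaloisModule (((p : ℕ) : ℤ) ^ k * ((p : ℕ) : ℤ)))
    (W.torsionGaloisModule ((p : ℕ) : ℤ)) (p ^ (k + 1)) z' ?_ ?_ ?_ f hf
  · intro g
    rw [hρz]
    exact Commute.neg_one_right _
  · intro g
    rw [hρbarz]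
    exact Commute.neg_one_right _
  · exact InflRes.bijective_rho_sub_self_of_eq_neg (W.torsionGaloisModule ((p : ℕ) : ℤ)).toTopRep z'
      (fun x => by change z' • x = -x; exact hz'p x) p (hpP.odd_of_ne_two hp) htors

/-! ## §4. `p = 3`: from `Irr W 3` alone (part 11c), every level; class forms -/

variable [W.IsElliptic]

/-- **`E[3]` irreducible ⟹ `−1 ∈ ρ̄_{E,3^{k+1}}(Γ_ℚ)` for every `k`**: some `z ∈ Γ_ℚ` acts as `−1`
on `E[3^k · 3]` (part 11c's involution on `E[3]`, lifted by §2).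
[cite: Serre1972, §2.4 Prop. 15 and §2.5] [cite: LawsonWuthrich2016, Lemma 3] -/
theorem exists_smul_eq_neg_three_pow_mul_of_irr (hirr : Irr W 3) (k : ℕ) :
    ∃ z : absoluteGaloisGroup ℚ,
      ∀ P : geomTorsion W (((3 : ℕ) : ℤ) ^ k * ((3 : ℕ) : ℤ)), z • P = -P :=
  exists_smul_eq_neg_torsion_pow_mul_of_exists W (by decide) k
    (exists_smul_eq_neg_three_of_irr W hirr)

/-- **(H.3) at EVERY level `3^{k+1}` for EVERY `E/ℚ` with `E[3]` irreducible** — VERBATIM the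
binder `hH3` of `GaloisImage.kolyvaginSystems_freeRankOne_propagatedSelmerStructure` (n1011-p13)
and of `hH3_three_of_towerSurj` (n1011-p04), now from `Irr W 3` alone: every continuous crossed
homomorphism `f : Γ_ℚ → E[3]` vanishing on `ker ρ̄_{E,3^{k+1}} ∩ Gal(ℚ̄/ℚ(μ_{3^{k+1}}))` is
principal. [cite: Sakamoto2024, §2 (H.3)] [cite: MazurRubin2004, Lemma 3.5.2]
[cite: Serre1972, §2.4 Prop. 15] -/
theorem hH3_three_pow_of_irr (hirr : Irr W 3) (k : ℕ)
    (f : contOneCocycles (W.torsionGaloisModule ((3 : ℕ) : ℤ)).toTopRep)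
    (hf : ∀ u : absoluteGaloisGroup ℚ,
      (W.torsionGaloisModule (((3 : ℕ) : ℤ) ^ k * ((3 : ℕ) : ℤ))) u = 1 →
        u ∈ rootsOfUnityFixer ℚ (3 ^ (k + 1)) → f.1 u = 0) :
    oneCocycleClass (W.torsionGaloisModule ((3 : ℕ) : ℤ)).toTopRep f = 0 := by
  haveI : Fact (Nat.Prime 3) := ⟨Nat.prime_three⟩
  obtain ⟨z, hz⟩ := exists_smul_eq_neg_three_of_irr W hirr
  exact hH3_of_smul_eq_neg W 3 k (by decide) z hz f hf

/-- **O8 / N11 at `p = 3` (`ClassX4 W 3`: EVERY row of X4 at `3`, surjective image or not): (H.3) at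
every level `3^{k+1}`.** [cite: Sakamoto2024, §2 (H.3)] [cite: Serre1972, §2.4 Prop. 15] -/
theorem O8.hH3_three_pow (hX : ClassX4 W 3) (k : ℕ)
    (f : contOneCocycles (W.torsionGaloisModule ((3 : ℕ) : ℤ)).toTopRep)
    (hf : ∀ u : absoluteGaloisGroup ℚ,
      (W.torsionGaloisModule (((3 : ℕ) : ℤ) ^ k * ((3 : ℕ) : ℤ))) u = 1 →
        u ∈ rootsOfUnityFixer ℚ (3 ^ (k + 1)) → f.1 u = 0) :
    oneCocycleClass (W.torsionGaloisModule ((3 : ℕ) : ℤ)).toTopRep f = 0 :=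
  hH3_three_pow_of_irr W hX.2.2 k f hf

/-- **N2 = X10b (class X10, any `ρ̄_{E,3}`): (H.3) at every level `3^{k+1}`.**
[cite: Sakamoto2024, §2 (H.3)] [cite: Serre1972, §2.4 Prop. 15] -/
theorem ClassX10.hH3_three_pow {p : ℕ} [Fact p.Prime] [W.IsGloballyMinimal] (h : ClassX10 W p)
    (k : ℕ) (f : contOneCocycles (W.torsionGaloisModule ((3 : ℕ) : ℤ)).toTopRep)
    (hf : ∀ u : absoluteGaloisGroup ℚ,
      (W.torsionGaloisModule (((3 : ℕ) : ℤ) ^ k * ((3 : ℕ) : ℤ))) u = 1 →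
        u ∈ rootsOfUnityFixer ℚ (3 ^ (k + 1)) → f.1 u = 0) :
    oneCocycleClass (W.torsionGaloisModule ((3 : ℕ) : ℤ)).toTopRep f = 0 :=
  hH3_three_pow_of_irr W h.2.2.1 k f hf

/-! ## §5. The N11 instance of Sakamoto Thm. 4.4 (1) re-keyed: `Irr W 3` + the `τ` of (H.2) -/

omit [W.IsElliptic] in
/-- **(H.1) in the fact's spelling IS `Irr W p`.** [cite: Sakamoto2024, §2 (H.1)] -/
theorem residual_irreducible_of_irr {p : ℕ} [Fact p.Prime] (hirr : Irr W p)
    (H : AddSubgroup (geomTorsion W (p : ℤ)))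
    (hH : ∀ (σ : absoluteGaloisGroup ℚ) (x : geomTorsion W (p : ℤ)), x ∈ H →
      (W.torsionGaloisModule (p : ℤ)) σ x ∈ H) :
    H = ⊥ ∨ H = ⊤ :=
  hirr H fun σ P hP => by
    have := hH σ P hP
    rwa [torsionGaloisModule_apply_apply] at this

/-- **The N11 instance of Sakamoto's Theorem 4.4 (1), keyed on `Irr W 3` and the `τ` of (H.2).**
VERBATIM n1011-p13's `kolyvaginSystems_freeRankOne_propagatedSelmerStructure` (`T = E[3^{k+1}]`,
`𝓕 = 𝓕_can`), with two changes in the HYPOTHESES and none in the conclusion: the `3`-adic tower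
binder `htower : ∀ n, ρ̄_{E,3ⁿ} onto` is REPLACED by `hirr : Irr W 3` ((H.1) is the class definition),
and the binder `hH3` is GONE ((H.3) at level `3^{k+1}` is `hH3_three_pow_of_irr`). What remains of the
image: the element `τ ∈ Gal(ℚ̄/ℚ(μ_{3^{k+1}}))` with `E[3^{k+1}]/(τ − 1) ≃ ℤ/3^{k+1}` ((H.2), binders
`τ, hτμ, hτq` — supplied by the tower via `exists_rootsOfUnityFixer_cokerSubOne_equiv_of_towerSurj`,
absent at level `9` on the exotic rows and at every level on the small-image rows). Every other
binder as in p13's theorem; CONDITIONAL on the named fact `hS24` (Sakamoto 2024 Thm. 4.4, debt of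
the tree). [cite: Sakamoto2024, §2 (H.1)–(H.3) and Thm. 4.4 (1)] -/
theorem kolyvaginSystems_freeRankOne_propagatedSelmerStructure_of_irr
    (hS24 : Sakamoto2024.kolyvaginSystems_freeRankOne_zmod_three_pow) (k : ℕ)
    [Finite (geomTorsion W ((3 : ℕ) : ℤ))] [Finite (geomTorsion W (((3 : ℕ) : ℤ) ^ k * ((3 : ℕ) : ℤ)))]
    (hirr : Irr W 3)
    (τ : absoluteGaloisGroup ℚ) (hτμ : τ ∈ rootsOfUnityFixer ℚ (3 ^ (k + 1)))
    (hτq : Nonempty (cokerSubOne (W.torsionGaloisModule (((3 : ℕ) : ℤ) ^ k * ((3 : ℕ) : ℤ))) τ ≃+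
      ZMod (3 ^ (k + 1))))
    (θ : (W.torsionGaloisModule ((3 : ℕ) : ℤ)).toContRepresentation →ⁱL
      ((W.torsionGaloisModule ((3 : ℕ) : ℤ)).tateDual 3).toContRepresentation)
    (hθ : Function.Bijective θ)
    (inv : LocalInvariants ℚ 3) (hperf : inv.IsPerfect) (hsum : inv.SumLocalTermEqZero)
    (hunro : inv.UnramifiedOrthogonal) (hcompl : inv.SelmerComplement)
    (S : Finset (Place ℚ)) (hS : ∀ w : InfinitePlace ℚ, (Sum.inl w : Place ℚ) ∈ S)
    (hS' : ∀ v : HeightOneSpectrum (𝓞 ℚ), (Sum.inr v : Place ℚ) ∉ S →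
      ((3 : ℕ) : 𝓞 ℚ) ∉ v.asIdeal ∧ GaloisRep.IsUnramifiedAt v (W.torsionGaloisModule (((3 : ℕ) : ℤ) ^ k * ((3 : ℕ) : ℤ))))
    (hunr : (propagatedSelmerStructure W 3 k).IsUnramifiedOutside S)
    (hCR : LocalInvariants.HasCoreRank inv (propagatedSelmerStructureOne W 3) 3 1)
    (hco : inv.IsResiduallyCoisotropic (propagatedSelmerStructureOne W 3) θ S)
    (D : KolyvaginDatum (W.torsionGaloisModule (((3 : ℕ) : ℤ) ^ k * ((3 : ℕ) : ℤ))))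
    (η : (q : HeightOneSpectrum (𝓞 ℚ)) → (ZMod (Ideal.absNorm q.asIdeal))ˣ)
    (hP : D.primes = frobeniusClassPrimes (W.torsionGaloisModule (((3 : ℕ) : ℤ) ^ k * ((3 : ℕ) : ℤ)))
      {v | (Sum.inr v : Place ℚ) ∈ S} τ (3 ^ (k + 1)))
    (hT : D.transverse = cyclotomicTransverse (W.torsionGaloisModule (((3 : ℕ) : ℤ) ^ k * ((3 : ℕ) : ℤ))))
    (hD : D.HasCanonicalComparison (3 ^ (k + 1)) η) :
    KolyvaginSystem.IsFreeRankOneZMod (D.kolyvaginSystems (propagatedSelmerStructure W 3 k))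
        (3 ^ (k + 1)) ∧
      ∀ (d : Finset (HeightOneSpectrum (𝓞 ℚ))) (hd : D.IsLevel d),
        LocalInvariants.lambdaStar inv ((D.atLevel (propagatedSelmerStructure W 3 k) d).induced
          (W.torsionMulBy (((3 : ℕ) : ℤ) ^ k) ((3 : ℕ) : ℤ))) 3 = 0 →
        Function.Bijective fun κ : D.kolyvaginSystems (propagatedSelmerStructure W 3 k) =>
          (⟨κ.1 d, ((KolyvaginDatum.mem_kolyvaginSystems_iff D _ κ.1).mp κ.2).mem_selmerGroup
              d hd⟩ : (D.atLevel (propagatedSelmerStructure W 3 k) d).selmerGroup) := by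
  haveI : NeZero ((3 : ℕ) : ℚ) := ⟨by norm_num⟩
  haveI : Fact (Nat.Prime 3) := ⟨Nat.prime_three⟩
  have hcart := isCartesian_propagatedSelmerStructure W 3 k S
  have hCR' : LocalInvariants.HasCoreRank inv
      ((propagatedSelmerStructure W 3 k).induced (W.torsionMulBy (((3 : ℕ) : ℤ) ^ k) ((3 : ℕ) : ℤ))) 3 1 := by
    rw [induced_propagatedSelmerStructure]; exact hCR
  have hco' : inv.IsResiduallyCoisotropic
      ((propagatedSelmerStructure W 3 k).induced (W.torsionMulBy (((3 : ℕ) : ℤ) ^ k) ((3 : ℕ) : ℤ))) θ S := by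
    rw [induced_propagatedSelmerStructure]; exact hco
  exact hS24 (geomTorsion W (((3 : ℕ) : ℤ) ^ k * ((3 : ℕ) : ℤ))) (geomTorsion W ((3 : ℕ) : ℤ)) (k + 1)
    (W.torsionGaloisModule _) (W.torsionGaloisModule _) (W.torsionMulBy (((3 : ℕ) : ℤ) ^ k) ((3 : ℕ) : ℤ))
    (W.torsionInclusion (Dvd.intro_left _ rfl)) τ θ inv S (propagatedSelmerStructure W 3 k) D η
    (torsionMulBy_pow_surjective W 3 k) (torsionMulBy_pow_eq_zero_iff W 3 k)
    (torsionInclusion_torsionMulBy_pow W 3 k) (residual_irreducible_of_irr W hirr) hτμ hτq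
    (hH3_three_pow_of_irr W hirr k) hθ hperf hsum hunro hcompl hS hS' hunr hcart hCR' hco' hP hT hD

end Rat

end Summit.BirchSwinnertonDyer.Rank1Residual.GaloisImage

end
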